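import Summits.QuantumAdvantage.QuantumAdvantage.Theses.DWalkThree
import HarnessLib

/-!
# Route DWalkThree, support `OddOneOut3` (stmt-QuantumAdvantage-22908): E1, the odd-one-out identity over `ℤ/3`

E1 (cell ROUND-15 §9.1): for any finite bell family `w : Fin m → Bool`, nonzero coefficients `a_k` and offsets `c_k` in `ℤ/3`,
the number of hidden trits `T ∈ ℤ/3` for which an ODD number of ringing bells `k` (`w k = true`) have `a_k·T + c_k ≠ 1` is EVEN
(hence `0` or `2`).  Proof (double counting mod 2): the parity of `#{T : odd count}` is the parity of `Σ_T count(T)`, and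
`Σ_T count(T) = Σ_{k ringing} #{T : a_k T + c_k ≠ 1} = Σ_{k ringing} 2` because `a_k` is a unit of `ℤ/3`, so exactly one `T`
has `a_k T + c_k = 1`.
WHAT THIS IS NOT: a counting identity only (consumed by R0 `RingFixedBellsSharp3`, E2 `RingUnreadGap3` and the dense residual's
normal form); no hardness statement; separation NOT moved.
-/

set_option linter.dupNamespace false

namespace Summit.QuantumAdvantage.QuantumAdvantage.Theorems

/-- One bell is live for exactly two of the three hidden trits: for a unit `a` of `ℤ/3` and any offset `c`,
`#{T : a·T + c ≠ 1} = 2`. -/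
theorem oddOneOut3_card_live (a c : ZMod 3) (ha : a ≠ 0) :
    (Finset.univ.filter fun T : ZMod 3 => a * T + c ≠ 1).card = 2 := by
  revert a c
  decide

/-- Parity of the number of odd values of `f` on a finset = parity of the sum of `f`. -/
theorem oddOneOut3_card_filter_odd_mod_two {ι : Type*} (s : Finset ι) (f : ι → ℕ) :
    (s.filter fun i => Odd (f i)).card % 2 = (s.sum f) % 2 := by
  classical
  rw [Finset.card_filter]
  conv_rhs => rw [Finset.sum_nat_mod]
  congr 1
  refine Finset.sum_congr rfl fun i _ => ?_
  rcases Nat.mod_two_eq_zero_or_one (f i) with h | h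
  · rw [if_neg (by rw [Nat.odd_iff]; omega), h]
  · rw [if_pos (Nat.odd_iff.mpr h), h]

open Summit.QuantumAdvantage.QuantumAdvantage.Theses.DWalkThree in
/-- **E1 `OddOneOut3` — PROVED**: for nonzero `a_k`, evenly many `T ∈ ℤ/3` make an odd number of ringing bells `k` satisfy
`a_k·T + c_k ≠ 1`. -/
theorem dWalkThree_oddOneOut3 : Summit.QuantumAdvantage.QuantumAdvantage.Theses.DWalkThree.OddOneOut3 := by
  unfold OddOneOut3
  intro m w a c ha
  classical
  rw [Nat.even_iff, oddOneOut3_card_filter_odd_mod_two]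
  -- double counting: `Σ_T count(T) = Σ_k [w k]·#{T : a_k T + c_k ≠ 1} = Σ_k [w k]·2`
  have hswap : (Finset.univ.sum fun T : ZMod 3 =>
      (Finset.univ.filter fun k : Fin m => w k = true ∧ a k * T + c k ≠ 1).card)
      = Finset.univ.sum fun k : Fin m =>
          if w k = true then (Finset.univ.filter fun T : ZMod 3 => a k * T + c k ≠ 1).card else 0 := by
    simp_rw [Finset.card_filter]
    rw [Finset.sum_comm]
    refine Finset.sum_congr rfl fun k _ => ?_
    by_cases hk : w k = true
    · simp [hk]
    · simp [hk]
  rw [hswap, Finset.sum_nat_mod]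
  have hterm : ∀ k : Fin m,
      (if w k = true then (Finset.univ.filter fun T : ZMod 3 => a k * T + c k ≠ 1).card else 0) % 2 = 0 := by
    intro k
    by_cases hk : w k = true
    · rw [if_pos hk, oddOneOut3_card_live (a k) (c k) (ha k)]
    · rw [if_neg hk]
  simp only [hterm, Finset.sum_const_zero, Nat.zero_mod]

end Summit.QuantumAdvantage.QuantumAdvantage.Theorems
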